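import Summits.ResolutionOfSingularities.ResolutionOfSingularities.Theorems.PurelyInseparableDim4PureLeafClassClosure
import Summits.ResolutionOfSingularities.ResolutionOfSingularities.Theorems.PurelyInseparableDim4PureLeafGlobalWinStatement
import HarnessLib
import HarnessLib.Audit.Tags

/-!
# Purely inseparable fourfolds — EVERY PURE LEAF WINS THE PLAIN GLOBAL GAME over `𝔽₂` at `q = 2`
# (cell res-dim4-pi; D3b (R4): `PureLeafGlobalWin.PureLeafGlobalWinQuestion` settled in the kernel)
# [OURS · counted 0 · a theorem about OUR coordinate-centre frame v4, not about resolution]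

Width seat `res-dim4-p-10` (g3).  The typed question `PureLeafGlobalWinQuestion` of `…PureLeafGlobalWinStatement`
(p-10 g2, WORD #60; one odd exponent: `PureLeafNF.stateWins_monomial_oneOdd`, p682020) is a THEOREM for every
exponent vector: for every `a : Fin 4 → ℕ` and every booking `(r, exc)`, `StateWins 2 ⟨x^a, r, exc⟩` over `𝔽₂` —
player A, blowing up coordinate centres, beats EVERY sequence of `𝔽₂`-rational replies of B in the tree's `Edge`
(chart `j ∈ S`, point `b` with `b_j = 0`, along-centre moves included): after finitely many moves no equimultiple
non-zero reply is left.

The proof is the paper proof of HOME `res-dim4-p-10/D3b-PAPER.md`, kernel-checked: the class «PRODUCT states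
`∏ xᵢ^{aᵢ}(1+xᵢ)^{eᵢ}` with (I5) `eᵢ` odd ⇒ `aᵢ = 0` and (I6) a mixed variable (`aᵢ` odd, `eᵢ > 0`) is the only
non-even one ∪ L-STATES `∏ xᵢ^{aᵢ}(1+xᵢ)^{eᵢ}·(∏_{i∈T}(1+xᵢ) + 1)` (all exponents even, `aᵢ = 0` on `T`, `|T| ≥ 2`)»
contains the pure leaves, and from every state of it A has a move all of whose answers are again in the class with a
smaller measure `Σ (aᵢ+eᵢ)` (`+ |T|`) — the singleton centre `{x_j}` when some `a_j ≥ 2` (`step_singleton_classU`,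
`step_singleton_classL`), else the pair `{x_j, x_k}` of two pure variables (`step_pair_classU`); states with `Σ aᵢ ≤ 1`
(products) resp. `a = 0` (L-states: order `1`) have no permissible centre and are won outright.  The parity
bookkeeping is `…PureLeafClassParity` (p683318), the closure under every reply `…PureLeafClassClosure`; the transition
algebra and normal forms are p-10 g2's `…PureLeafNormalForms` / `…PureLeafTransitions{,L,Pair}`.

* `ordAlong_prod`, `two_le_ordAlong_singleton_prod_mul`, `coeff_add_single_prod`, `coeff_add_single_L`,
  `not_isPermissibleCentre_L` — legality of A's centres / terminal positions;
* **`stateWins_classes`** — the class is contained in A's attractor (strong induction on the measure);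
* **`stateWins_monomial`** — `∀ a r exc, StateWins 2 ⟨x^a, r, exc⟩` over `𝔽₂` (for an all-even `a` the «leaf» is
  a square, every reply cleans to `0`, and the win is the frame's degenerate one);
* **`pureLeafGlobalWin : PureLeafGlobalWin.PureLeafGlobalWinQuestion`**; `inScopeStateWins_monomial`.

Riders: `𝔽₂`-rational replies only (the game over `ZMod 2`; the every-field form needs multi-root univariate factors
and is NOT claimed); A's centres are Hironaka-permissible coordinate centres of least cardinality among those the
proof uses, no claim about the engines' lex tie-break; NOT F4-C(2,2) (pure leaves only).  Nothing here proves
resolution of singularities in dimension ≥ 4 / characteristic `p`; counted 0; AI work, weaker than expert review.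
bears_on: LADDER-RESOLUTION:D157-DOOR2 (res-dim4-pi · WORD #60 D3b (R4) · WORD #107 (b)). Supports
stmt-ResolutionOfSingularities-16155 (helper).
-/

set_option linter.dupNamespace false

open MvPolynomial Finset

open scoped BigOperators

noncomputable section

namespace Summit.ResolutionOfSingularities.ResolutionOfSingularities.Theorems.PIDim4

namespace PureLeafNF

open Literature.AlgebraicGeometry.Resolution
open Literature.AlgebraicGeometry.Resolution.Hauser2010
open CentreBlowup PthPowerFactor

/-! ## 1. Legality of A's centres; terminal positions -/

/-- `ord_{(x_S)} N(a,e) = Σ_{i∈S} aᵢ`. [folklore] -/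
theorem ordAlong_prod (a e : Fin 4 → ℕ) (S : Finset (Fin 4)) :
    ordAlong S (∏ i, X i ^ a i * (1 + X i) ^ e i : MvPolynomial (Fin 4) (ZMod 2)) =
      (degIn S (Finsupp.equivFunOnFinite.symm a) : ℕ∞) :=
  LeafStep.ordAlong_eq_degIn S
    (⟨∏ i, X i ^ a i * (1 + X i) ^ e i, Finsupp.equivFunOnFinite.symm a, ∅⟩ : State (ZMod 2))
    (fun _ hd => le_of_mem_support_prod a e hd)
    (by
      show coeff (Finsupp.equivFunOnFinite.symm a)
        (∏ i, X i ^ a i * (1 + X i) ^ e i : MvPolynomial (Fin 4) (ZMod 2)) ≠ 0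
      rw [coeff_self_prod]; exact one_ne_zero)

/-- The singleton centre `{x_j}` with `2 ≤ a_j` is permissible at `N(a,e)·G` for every cofactor `G`. [folklore] -/
theorem two_le_ordAlong_singleton_prod_mul (a e : Fin 4 → ℕ) {j : Fin 4} (hj : 2 ≤ a j)
    (G : MvPolynomial (Fin 4) (ZMod 2)) :
    (2 : ℕ∞) ≤ ordAlong {j} ((∏ i, X i ^ a i * (1 + X i) ^ e i) * G) := by
  rw [prod_eq_X_sq_mul a e hj, mul_assoc]
  refine le_trans ?_ (ordAlong_add_ordAlong_le_mul {j} _ _)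
  rw [ordAlong_X_pow, if_pos (Finset.mem_singleton_self j), Nat.cast_ofNat]
  exact le_self_add

/-- The monomial `x^a · x_i` of `N(a,e)` has coefficient `e_i`. [folklore] -/
theorem coeff_add_single_prod (a e : Fin 4 → ℕ) (i : Fin 4) :
    coeff (Finsupp.equivFunOnFinite.symm a + Finsupp.single i 1)
      (∏ k, X k ^ a k * (1 + X k) ^ e k : MvPolynomial (Fin 4) (ZMod 2)) = (e i : ZMod 2) := by
  rw [prod_eq_monomial_mul, coeff_monomial_mul', if_pos le_self_add, one_mul, add_tsub_cancel_left,
    coeff_single_prod_one_add]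

/-- In an L-polynomial `N(a,e)·(∏_{T}(1+x_k)+1)` the monomial `x^a · x_i`, `i ∈ T`, has coefficient `1`. [folklore] -/
theorem coeff_add_single_L (a e : Fin 4 → ℕ) (T : Finset (Fin 4)) {i : Fin 4} (hi : i ∈ T) :
    coeff (Finsupp.equivFunOnFinite.symm a + Finsupp.single i 1) ((∏ k, X k ^ a k * (1 + X k) ^ e k) *
      ((∏ k, X k ^ (0 : ℕ) * (1 + X k) ^ (if k ∈ T then 1 else 0) : MvPolynomial (Fin 4) (ZMod 2)) + 1)) =
      1 := by
  rw [mul_add, mul_one, prod_mul_prod, coeff_add, coeff_add_single_prod a e]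
  simp only [add_zero]
  rw [coeff_add_single_prod a, if_pos hi, Nat.cast_add, Nat.cast_one]
  generalize (e i : ZMod 2) = x
  revert x
  decide

/-- **An L-polynomial with `a = 0` (`T ≠ ∅`) has NO permissible coordinate centre**: its order is `1`. [folklore] -/
theorem not_isPermissibleCentre_L (a e : Fin 4 → ℕ) (ha : ∀ i, a i = 0) (T : Finset (Fin 4))
    (hT : T.Nonempty) (S : Finset (Fin 4)) :
    ¬ IsPermissibleCentre 2 S ((∏ k, X k ^ a k * (1 + X k) ^ e k) *
      ((∏ k, X k ^ (0 : ℕ) * (1 + X k) ^ (if k ∈ T then 1 else 0) : MvPolynomial (Fin 4) (ZMod 2)) + 1)) := by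
  rintro ⟨-, h2⟩
  obtain ⟨i, hi⟩ := hT
  have hc := coeff_add_single_L a e T hi
  have ha0 : Finsupp.equivFunOnFinite.symm a = 0 := by
    ext k; exact ha k
  rw [ha0, zero_add] at hc
  have hle := ordAlong_le_of_coeff_ne_zero (S := S) (F := (∏ k, X k ^ a k * (1 + X k) ^ e k) *
      ((∏ k, X k ^ (0 : ℕ) * (1 + X k) ^ (if k ∈ T then 1 else 0) : MvPolynomial (Fin 4) (ZMod 2)) + 1))
    (d := Finsupp.single i 1) (by rw [hc]; exact one_ne_zero)
  have h := le_trans h2 hle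
  rw [degIn_single] at h
  have h' : (2 : ℕ) ≤ (if i ∈ S then 1 else 0) := by exact_mod_cast h
  split_ifs at h' <;> omega

/-! ## 2. The class is contained in A's attractor -/

/-- **THE PURE-LEAF CLASS IS WINNING.** For every `n`: (U) every product state `N(a,e)` over `𝔽₂` with (I5), (I6) and
`Σ (aᵢ+eᵢ) ≤ n` is an A-win of the plain global game at `q = 2`, every booking; (L) every L-state
`N(a,e)·(∏_{T}(1+xᵢ)+1)` with all exponents even, `aᵢ = 0` on `T`, `|T| ≥ 2` and `Σ (aᵢ+eᵢ) + |T| ≤ n` likewise.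
[OURS · counted 0] [folklore] -/
theorem stateWins_classes : ∀ n : ℕ,
    (∀ (a e : Fin 4 → ℕ), ∑ i, (a i + e i) ≤ n →
      (∀ i, e i % 2 = 1 → a i = 0) →
      (∀ i, a i % 2 = 1 → 0 < e i → ∀ i', i' ≠ i → a i' % 2 = 0 ∧ e i' % 2 = 0) →
      ∀ (r : Fin 4 →₀ ℕ) (exc : Finset (Fin 4)),
        StateWins 2 (⟨∏ i, X i ^ a i * (1 + X i) ^ e i, r, exc⟩ : State (ZMod 2))) ∧
    (∀ (a e : Fin 4 → ℕ) (T : Finset (Fin 4)), ∑ i, (a i + e i) + T.card ≤ n →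
      (∀ i, a i % 2 = 0) → (∀ i, e i % 2 = 0) → (∀ i ∈ T, a i = 0) → 2 ≤ T.card →
      ∀ (r : Fin 4 →₀ ℕ) (exc : Finset (Fin 4)),
        StateWins 2 (⟨(∏ i, X i ^ a i * (1 + X i) ^ e i) *
          ((∏ i, X i ^ (0 : ℕ) * (1 + X i) ^ (if i ∈ T then 1 else 0) : MvPolynomial (Fin 4) (ZMod 2)) + 1),
          r, exc⟩ : State (ZMod 2))) := by
  intro n
  induction n using Nat.strong_induction_on with
  | _ n IH =>
  have hstate : ∀ t : State (ZMod 2), t = ⟨t.F, t.r, t.exc⟩ := fun t => rfl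
  refine ⟨fun a e hn hI5 hI6 r exc => ?_, fun a e T hn ha he haT hT r exc => ?_⟩
  · -- PRODUCT STATES
    unfold StateWins
    by_cases hsmall : ∑ i, a i ≤ 1
    · -- `Σ a ≤ 1`: no permissible coordinate centre, A has won
      refine Game.Wins.terminal fun S hS => ?_
      have h2 : (2 : ℕ∞) ≤ ordAlong S (∏ i, X i ^ a i * (1 + X i) ^ e i : MvPolynomial (Fin 4) (ZMod 2)) :=
        hS.2
      rw [ordAlong_prod] at h2
      have h3 : degIn S (Finsupp.equivFunOnFinite.symm a) ≤ ∑ i, a i := by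
        unfold degIn
        exact Finset.sum_le_sum_of_subset_of_nonneg (Finset.subset_univ S) fun i _ _ => Nat.zero_le _
      have h4 : (2 : ℕ) ≤ degIn S (Finsupp.equivFunOnFinite.symm a) := by exact_mod_cast h2
      omega
    · rw [not_le] at hsmall
      by_cases hbig : ∃ j, 2 ≤ a j
      · -- (U1) the singleton centre `{x_j}`
        obtain ⟨j, hj⟩ := hbig
        refine Game.Wins.move (m := ({j} : Finset (Fin 4))) ⟨Finset.singleton_nonempty j, ?_⟩ ?_
        · show (2 : ℕ∞) ≤ ordAlong {j} (∏ i, X i ^ a i * (1 + X i) ^ e i : MvPolynomial (Fin 4) (ZMod 2))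
          rw [ordAlong_prod, degIn_singleton]
          exact_mod_cast hj
        rintro s' ⟨j', b, hj', hbj, heq, hne, rfl⟩
        rw [Finset.mem_singleton] at hj'
        subst hj'
        rw [hstate (step 2 {j'} j' b _)]
        rcases step_singleton_classU (⟨∏ i, X i ^ a i * (1 + X i) ^ e i, r, exc⟩ : State (ZMod 2)) a e rfl
            hI5 hI6 hj b hne with
          ⟨a₁, e₁, h1, h5, h6, hm⟩ | ⟨a₁, e₁, T, h1, h2, h3, h4, h5, hm⟩
        · rw [h1]; exact (IH _ (by omega)).1 a₁ e₁ le_rfl h5 h6 _ _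
        · rw [h1]; exact (IH _ (by omega)).2 a₁ e₁ T le_rfl h2 h3 h4 h5 _ _
      · -- (U2) all `aᵢ ≤ 1`, `Σ a ≥ 2`: two pure variables `x_j`, `x_k`, the pair centre `{x_j, x_k}`
        push Not at hbig
        obtain ⟨j, hj⟩ : ∃ j, a j = 1 := by
          by_contra hno
          push Not at hno
          have h0 : ∑ i, a i = 0 :=
            Finset.sum_eq_zero fun i _ => by have := hbig i; have := hno i; omega
          omega
        obtain ⟨k, hkj, hk⟩ : ∃ k, k ≠ j ∧ a k = 1 := by
          by_contra hno
          push Not at hno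
          have hsum := Finset.add_sum_erase Finset.univ a (Finset.mem_univ j)
          have hrest : ∑ i ∈ Finset.univ.erase j, a i = 0 :=
            Finset.sum_eq_zero fun i hi => by
              have h1 := hbig i; have h2 := hno i (Finset.ne_of_mem_erase hi); omega
          omega
        have hjk : j ≠ k := fun h => hkj h.symm
        refine Game.Wins.move (m := ({j, k} : Finset (Fin 4))) ⟨⟨j, Finset.mem_insert_self j {k}⟩, ?_⟩ ?_
        · show (2 : ℕ∞) ≤ ordAlong {j, k} (∏ i, X i ^ a i * (1 + X i) ^ e i : MvPolynomial (Fin 4) (ZMod 2))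
          rw [ordAlong_prod, degIn_pair hjk]
          show (2 : ℕ∞) ≤ ((a j + a k : ℕ) : ℕ∞)
          rw [hj, hk]
          exact le_of_eq (by norm_num)
        -- both charts `x_j`, `x_k` by symmetry
        have hchart : ∀ (j₁ k₁ : Fin 4), j₁ ≠ k₁ → a j₁ = 1 → a k₁ = 1 → ∀ (b : Fin 4 → ZMod 2),
            (step 2 {j₁, k₁} j₁ b (⟨∏ i, X i ^ a i * (1 + X i) ^ e i, r, exc⟩ : State (ZMod 2))).F ≠ 0 →
            Game.Wins (fun (t : State (ZMod 2)) (S : Finset (Fin 4)) => IsPermissibleCentre 2 S t.F)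
              (fun t S t' => Edge 2 S t t')
              (step 2 {j₁, k₁} j₁ b (⟨∏ i, X i ^ a i * (1 + X i) ^ e i, r, exc⟩ : State (ZMod 2))) := by
          intro j₁ k₁ hjk₁ hj₁ hk₁ b hne
          rw [hstate (step 2 {j₁, k₁} j₁ b _)]
          rcases step_pair_classU (⟨∏ i, X i ^ a i * (1 + X i) ^ e i, r, exc⟩ : State (ZMod 2)) a e rfl
              hI5 hI6 hjk₁ hj₁ hk₁ b hne with
            ⟨a₁, e₁, h1, h5, h6, hm⟩ | ⟨a₁, e₁, T, h1, h2, h3, h4, h5, hm⟩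
          · rw [h1]; exact (IH _ (by omega)).1 a₁ e₁ le_rfl h5 h6 _ _
          · rw [h1]; exact (IH _ (by omega)).2 a₁ e₁ T le_rfl h2 h3 h4 h5 _ _
        rintro s' ⟨j', b, hj', hbj, heq, hne, rfl⟩
        rcases Finset.mem_insert.mp hj' with rfl | hj'k
        · exact hchart j' k hjk hj hk b hne
        · rw [Finset.mem_singleton] at hj'k
          subst hj'k
          rw [Finset.pair_comm] at hne ⊢
          exact hchart j' j hkj hk hj b hne
  · -- L-STATES
    unfold StateWins
    by_cases hzero : ∀ i, a i = 0
    · -- `a = 0`: order `1`, no permissible centre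
      exact Game.Wins.terminal fun S hS =>
        not_isPermissibleCentre_L a e hzero T (Finset.card_pos.mp (by omega)) S hS
    · push Not at hzero
      obtain ⟨j, hj0⟩ := hzero
      have hj : 2 ≤ a j := by have := ha j; omega
      refine Game.Wins.move (m := ({j} : Finset (Fin 4)))
        ⟨Finset.singleton_nonempty j, two_le_ordAlong_singleton_prod_mul a e hj _⟩ ?_
      rintro s' ⟨j', b, hj', hbj, heq, hne, rfl⟩
      rw [Finset.mem_singleton] at hj'
      subst hj'
      rw [hstate (step 2 {j'} j' b _)]
      rcases step_singleton_classL (⟨(∏ i, X i ^ a i * (1 + X i) ^ e i) *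
          ((∏ i, X i ^ (0 : ℕ) * (1 + X i) ^ (if i ∈ T then 1 else 0) : MvPolynomial (Fin 4) (ZMod 2)) + 1),
          r, exc⟩ : State (ZMod 2)) a e T rfl ha he haT hj b with
        ⟨a₁, e₁, h1, h5, h6, hm⟩ | ⟨a₁, e₁, h1, h2, h3, h4, hm⟩
      · rw [h1]; exact (IH _ (by omega)).1 a₁ e₁ le_rfl h5 h6 _ _
      · rw [h1]; exact (IH _ (by omega)).2 a₁ e₁ T le_rfl h2 h3 h4 hT _ _

/-- **Every class product state wins**, every booking. [OURS · counted 0] [folklore] -/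
theorem stateWins_prod_class (a e : Fin 4 → ℕ) (hI5 : ∀ i, e i % 2 = 1 → a i = 0)
    (hI6 : ∀ i, a i % 2 = 1 → 0 < e i → ∀ i', i' ≠ i → a i' % 2 = 0 ∧ e i' % 2 = 0)
    (r : Fin 4 →₀ ℕ) (exc : Finset (Fin 4)) :
    StateWins 2 (⟨∏ i, X i ^ a i * (1 + X i) ^ e i, r, exc⟩ : State (ZMod 2)) :=
  (stateWins_classes _).1 a e le_rfl hI5 hI6 r exc

/-- **Every class L-state wins**, every booking. [OURS · counted 0] [folklore] -/
theorem stateWins_L_class (a e : Fin 4 → ℕ) (T : Finset (Fin 4)) (ha : ∀ i, a i % 2 = 0)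
    (he : ∀ i, e i % 2 = 0) (haT : ∀ i ∈ T, a i = 0) (hT : 2 ≤ T.card)
    (r : Fin 4 →₀ ℕ) (exc : Finset (Fin 4)) :
    StateWins 2 (⟨(∏ i, X i ^ a i * (1 + X i) ^ e i) *
      ((∏ i, X i ^ (0 : ℕ) * (1 + X i) ^ (if i ∈ T then 1 else 0) : MvPolynomial (Fin 4) (ZMod 2)) + 1),
      r, exc⟩ : State (ZMod 2)) :=
  (stateWins_classes _).2 a e T le_rfl ha he haT hT r exc

/-! ## 3. Every pure leaf wins -/

/-- **EVERY PURE MONOMIAL LEAF WINS THE PLAIN GLOBAL GAME OVER `𝔽₂`** (`q = 2`, all exponent vectors, every booking):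
`StateWins 2 ⟨x^a, r, exc⟩`.  (For an all-even `a` the monomial is a square — not a clean state — and every reply
cleans to `0`: the frame's degenerate win.) [OURS · counted 0] [folklore] -/
theorem stateWins_monomial (a : Fin 4 → ℕ) (r : Fin 4 →₀ ℕ) (exc : Finset (Fin 4)) :
    StateWins 2 (⟨monomial (Finsupp.equivFunOnFinite.symm a) 1, r, exc⟩ : State (ZMod 2)) := by
  have hN : (monomial (Finsupp.equivFunOnFinite.symm a) (1 : ZMod 2)) =
      ∏ i, X i ^ a i * (1 + X i) ^ (fun _ => (0 : ℕ)) i := by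
    rw [prod_eq_monomial_mul]; simp
  rw [hN]
  exact stateWins_prod_class a (fun _ => 0) (fun i hi => absurd hi (by decide))
    (fun i _ hi => absurd hi (Nat.lt_irrefl 0)) r exc

/-- **D3b SETTLED: `PureLeafGlobalWinQuestion` holds.** Every pure leaf `x^a` with an odd exponent (indeed every
`x^a`) and every booking is an A-win of the plain GLOBAL game over `𝔽₂` at `q = 2`. [OURS · counted 0] [folklore] -/
theorem pureLeafGlobalWin : PureLeafGlobalWin.PureLeafGlobalWinQuestion := by
  intro a _ r exc
  have h := stateWins_monomial (⇑a) r exc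
  rwa [Finsupp.equivFunOnFinite_symm_coe] at h

/-- … hence every pure leaf is in-scope escapable (F4-C attractor) over `𝔽₂`, every booking. [OURS · counted 0]
[folklore] -/
theorem inScopeStateWins_monomial (a : Fin 4 → ℕ) (r : Fin 4 →₀ ℕ) (exc : Finset (Fin 4)) :
    InScopeWinCert.InScopeStateWins 2
      (⟨monomial (Finsupp.equivFunOnFinite.symm a) 1, r, exc⟩ : State (ZMod 2)) :=
  InScopeWinCert.inScopeStateWins_of_stateWins (stateWins_monomial a r exc)

end PureLeafNF

end Summit.ResolutionOfSingularities.ResolutionOfSingularities.Theorems.PIDim4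

end
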